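import Summits.AtomisticToContinuum.Crystallization.Theorems.ExcessDecayLiouvillePhononStabilityCertFar

/-!
# Near-certificate: computable enumeration of the exact ranges `{c : qlo < Q(c) ≤ qhi}`

Support file for crux `PhononStability` (line `contragredient-window-collapse`), stub `stub_certRange`.
The integer form `Q(c) = 36‖ζ⁰_c‖² = 9(2n₀+n₁+s)² + 3(3n₁+s)² + 24(2n₂+s)²` of a bond class
`c = (m, m', n)` (`s = σ(m') − σ(m)`) is enumerated WITHOUT scanning a coordinate box: for each pair of
sublattices we run `n₂` over the integers with `|2n₂+s| ≤ ⌊√(qhi/24)⌋`, then `n₁` with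
`|3n₁+s| ≤ ⌊√(r₂/3)⌋` (`r₂` the budget left by `n₂`), then `n₀` over the two rays
`⌊√(r₁'/9)⌋ < |2n₀+n₁+s| ≤ ⌊√(r₁/9)⌋` (`r₁`, `r₁'` the budgets left w.r.t. `qhi`, `qlo`), and keep the
classes passing the exact test `qlo < Q(c) ≤ qhi`; the work is proportional to the size of the range plus
`O(qhi)` empty inner loops. We prove that the resulting list `classRange qlo qhi` has no duplicates and that
membership in it is EQUIVALENT to `qlo < Q(c) ≤ qhi` (every solution lies inside the nested ranges by
`k² ≤ r ⇔ |k| ≤ ⌊√r⌋`). [folklore]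
-/

noncomputable section

open scoped BigOperators Classical InnerProductSpace
open Filter Set Function
open Summit.AtomisticToContinuum.Crystallization.Theorems.PhononStabilityNegative
open Literature.MathematicalPhysics.StatisticalMechanics

namespace Summit.AtomisticToContinuum.Crystallization.Theorems.PhononStabilityCWC.Cert

/-! ## Integer intervals and square-root bounds -/

/-- the integers of `[lo, hi]` as a list (empty if `hi < lo`) -/
def intIcc (lo hi : ℤ) : List ℤ := (List.range (hi + 1 - lo).toNat).map fun i : ℕ => lo + (i : ℤ)

/-- membership in `intIcc`. [folklore] -/
theorem mem_intIcc {lo hi k : ℤ} : k ∈ intIcc lo hi ↔ lo ≤ k ∧ k ≤ hi := by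
  unfold intIcc
  rw [List.mem_map]
  constructor
  · rintro ⟨i, hir, rfl⟩
    rw [List.mem_range] at hir
    omega
  · rintro ⟨h1, h2⟩
    exact ⟨(k - lo).toNat, List.mem_range.mpr (by omega), by omega⟩

/-- `intIcc` has no duplicates. [folklore] -/
theorem nodup_intIcc (lo hi : ℤ) : (intIcc lo hi).Nodup := by
  unfold intIcc
  refine List.Nodup.map (fun i j h => ?_) List.nodup_range
  have h' : lo + (i : ℤ) = lo + (j : ℤ) := h
  omega

/-- the integers `n` with `|u n + v| ≤ t` (for `u > 0`): `[-⌊(v+t)/u⌋, ⌊(t-v)/u⌋]` -/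
def coordStrip (u v t : ℤ) : List ℤ := intIcc (-((v + t) / u)) ((t - v) / u)

/-- `coordStrip` has no duplicates. [folklore] -/
theorem nodup_coordStrip (u v t : ℤ) : (coordStrip u v t).Nodup := nodup_intIcc _ _

/-- the integers `n` with `⌊√A⌋ < |2n+v| ≤ ⌊√B⌋` (two rays), resp. with `|2n+v| ≤ ⌊√B⌋` if `A < 0` -/
def coordRays (v A B : ℤ) : List ℤ :=
  if A < 0 then coordStrip 2 v (Int.sqrt B)
  else intIcc (-((v + Int.sqrt B) / 2)) ((-Int.sqrt A - 1 - v) / 2) ++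
      intIcc (-((v - Int.sqrt A - 1) / 2)) ((Int.sqrt B - v) / 2)

/-- `coordRays` has no duplicates (the two rays are separated). [folklore] -/
theorem nodup_coordRays (v A B : ℤ) : (coordRays v A B).Nodup := by
  unfold coordRays
  split_ifs with h
  · exact nodup_coordStrip _ _ _
  · have hu := Int.sqrt_nonneg A
    refine List.nodup_append.mpr ⟨nodup_intIcc _ _, nodup_intIcc _ _, fun a ha b hb => ?_⟩
    rw [mem_intIcc] at ha hb
    omega

/-- membership in `coordRays` from the two bounds. [folklore] -/
theorem mem_coordRays {n v A B : ℤ} (hB : -Int.sqrt B ≤ 2 * n + v ∧ 2 * n + v ≤ Int.sqrt B)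
    (hA : 0 ≤ A → ¬(-Int.sqrt A ≤ 2 * n + v ∧ 2 * n + v ≤ Int.sqrt A)) : n ∈ coordRays v A B := by
  unfold coordRays
  split_ifs with h
  · unfold coordStrip; rw [mem_intIcc]; omega
  · have h' := hA (not_lt.mp h)
    rw [List.mem_append, mem_intIcc, mem_intIcc]; omega

/-- `k² ≤ r ⇒ |k| ≤ ⌊√r⌋`. [folklore] -/
theorem natAbs_le_sqrt {k r : ℤ} (h : k ^ 2 ≤ r) : (k.natAbs : ℤ) ≤ Int.sqrt r := by
  have h0 : ((r.toNat : ℕ) : ℤ) = r := Int.toNat_of_nonneg ((sq_nonneg k).trans h)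
  have h1 : ((k.natAbs ^ 2 : ℕ) : ℤ) ≤ ((r.toNat : ℕ) : ℤ) := by
    rw [Nat.cast_pow, Int.natAbs_pow_two, h0]; exact h
  have h2 : k.natAbs ≤ Nat.sqrt r.toNat := Nat.le_sqrt'.mpr (by exact_mod_cast h1)
  unfold Int.sqrt
  exact_mod_cast h2

/-- `a k² ≤ r`, `0 < a` ⇒ `|k| ≤ ⌊√(r/a)⌋` (integer division). [folklore] -/
theorem abs_le_sqrt_div {a k r : ℤ} (ha : 0 < a) (h : a * k ^ 2 ≤ r) :
    -Int.sqrt (r / a) ≤ k ∧ k ≤ Int.sqrt (r / a) := by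
  have h1 : k ^ 2 ≤ r / a := (Int.le_ediv_iff_mul_le ha).mpr (by rw [mul_comm]; exact h)
  have h2 := natAbs_le_sqrt h1
  omega

/-- `⌊√r⌋² ≤ r` for `0 ≤ r`. [folklore] -/
theorem sqrt_sq_le {r : ℤ} (h : 0 ≤ r) : Int.sqrt r ^ 2 ≤ r := by
  have h0 : ((r.toNat : ℕ) : ℤ) = r := Int.toNat_of_nonneg h
  have h1 : ((Nat.sqrt r.toNat : ℕ) : ℤ) ^ 2 ≤ ((r.toNat : ℕ) : ℤ) := by
    exact_mod_cast Nat.sqrt_le' r.toNat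
  unfold Int.sqrt
  rwa [h0] at h1

/-! ## The enumeration -/

/-- the sign difference `s = σ(m') − σ(m)` of a pair of sublattices -/
def signDiff (m m' : Fin 2) : ℤ := subSignZ m' - subSignZ m

/-- budget (w.r.t. the bound `q`) left for `n₁, n₀` once `n₂` is fixed -/
def budget₂ (q : ℤ) (m m' : Fin 2) (n₂ : ℤ) : ℤ := q - 24 * (2 * n₂ + signDiff m m') ^ 2

/-- budget (w.r.t. the bound `q`) left for `n₀` once `n₂, n₁` are fixed -/
def budget₁ (q : ℤ) (m m' : Fin 2) (n₂ n₁ : ℤ) : ℤ :=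
  budget₂ q m m' n₂ - 3 * (3 * n₁ + signDiff m m') ^ 2

/-- innermost loop: the classes `(m, m', (n₀, n₁, n₂))` with `qlo < Q ≤ qhi`, `n₀` over its two rays -/
def classCell (qlo qhi : ℤ) (m m' : Fin 2) (n₂ n₁ : ℤ) : List BondClass :=
  ((coordRays (n₁ + signDiff m m') (budget₁ qlo m m' n₂ n₁ / 9) (budget₁ qhi m m' n₂ n₁ / 9)).map
      fun n₀ : ℤ => ((m, m', ![n₀, n₁, n₂]) : BondClass)).filter
    fun c => decide (qlo < Qint c) && decide (Qint c ≤ qhi)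

/-- middle loop: `n₁` over its strip -/
def classSlab (qlo qhi : ℤ) (m m' : Fin 2) (n₂ : ℤ) : List BondClass :=
  (coordStrip 3 (signDiff m m') (Int.sqrt (budget₂ qhi m m' n₂ / 3))).flatMap
    fun n₁ => classCell qlo qhi m m' n₂ n₁

/-- outer loop: `n₂` over its strip -/
def classBlock (qlo qhi : ℤ) (m m' : Fin 2) : List BondClass :=
  (coordStrip 2 (signDiff m m') (Int.sqrt (qhi / 24))).flatMap fun n₂ => classSlab qlo qhi m m' n₂

/-- the four pairs of sublattices -/
def sublPairs : List (Fin 2 × Fin 2) := [(0, 0), (0, 1), (1, 0), (1, 1)]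

/-- **The exact range** `{c : qlo < Q(c) ≤ qhi}` as a computable duplicate-free list. -/
def classRange (qlo qhi : ℤ) : List BondClass :=
  sublPairs.flatMap fun p => classBlock qlo qhi p.1 p.2

/-! ## Shape of the members (soundness and the keys for disjointness) -/

/-- membership in the innermost loop. [folklore] -/
theorem mem_classCell {qlo qhi : ℤ} {m m' : Fin 2} {n₂ n₁ : ℤ} {c : BondClass} :
    c ∈ classCell qlo qhi m m' n₂ n₁ ↔
      (∃ n₀ ∈ coordRays (n₁ + signDiff m m') (budget₁ qlo m m' n₂ n₁ / 9) (budget₁ qhi m m' n₂ n₁ / 9),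
          ((m, m', ![n₀, n₁, n₂]) : BondClass) = c) ∧
        (qlo < Qint c ∧ Qint c ≤ qhi) := by
  simp only [classCell, List.mem_filter, List.mem_map, Bool.and_eq_true, decide_eq_true_eq]

/-- shape of the members of a cell. [folklore] -/
theorem shape_classCell {qlo qhi : ℤ} {m m' : Fin 2} {n₂ n₁ : ℤ} {c : BondClass}
    (h : c ∈ classCell qlo qhi m m' n₂ n₁) :
    c.1 = m ∧ c.2.1 = m' ∧ c.2.2 2 = n₂ ∧ c.2.2 1 = n₁ ∧ (qlo < Qint c ∧ Qint c ≤ qhi) := by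
  obtain ⟨⟨n₀, -, rfl⟩, hq⟩ := mem_classCell.mp h
  exact ⟨rfl, rfl, rfl, rfl, hq⟩

/-- shape of the members of a slab. [folklore] -/
theorem shape_classSlab {qlo qhi : ℤ} {m m' : Fin 2} {n₂ : ℤ} {c : BondClass}
    (h : c ∈ classSlab qlo qhi m m' n₂) :
    c.1 = m ∧ c.2.1 = m' ∧ c.2.2 2 = n₂ ∧ (qlo < Qint c ∧ Qint c ≤ qhi) := by
  unfold classSlab at h
  obtain ⟨n₁, -, hc⟩ := List.mem_flatMap.mp h
  obtain ⟨h1, h2, h3, -, hq⟩ := shape_classCell hc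
  exact ⟨h1, h2, h3, hq⟩

/-- shape of the members of a block. [folklore] -/
theorem shape_classBlock {qlo qhi : ℤ} {m m' : Fin 2} {c : BondClass}
    (h : c ∈ classBlock qlo qhi m m') : c.1 = m ∧ c.2.1 = m' ∧ (qlo < Qint c ∧ Qint c ≤ qhi) := by
  unfold classBlock at h
  obtain ⟨n₂, -, hc⟩ := List.mem_flatMap.mp h
  obtain ⟨h1, h2, -, hq⟩ := shape_classSlab hc
  exact ⟨h1, h2, hq⟩

/-- **soundness:** every listed class satisfies `qlo < Q(c) ≤ qhi`. [folklore] -/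
theorem qint_of_mem_classRange {qlo qhi : ℤ} {c : BondClass} (h : c ∈ classRange qlo qhi) :
    qlo < Qint c ∧ Qint c ≤ qhi := by
  unfold classRange at h
  obtain ⟨p, -, hc⟩ := List.mem_flatMap.mp h
  exact (shape_classBlock hc).2.2

/-! ## Completeness -/

/-- every pair of sublattices is listed. [folklore] -/
theorem mem_sublPairs : ∀ p : Fin 2 × Fin 2, p ∈ sublPairs := by decide

/-- **completeness:** every class with `qlo < Q(c) ≤ qhi` is listed. [folklore] -/
theorem mem_classRange_of_qint {qlo qhi : ℤ} {c : BondClass} (hlo : qlo < Qint c) (hhi : Qint c ≤ qhi) :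
    c ∈ classRange qlo qhi := by
  obtain ⟨m, m', n⟩ := c
  have hQ : Qint (m, m', n) = 9 * (2 * n 0 + (n 1 + signDiff m m')) ^ 2 +
      3 * (3 * n 1 + signDiff m m') ^ 2 + 24 * (2 * n 2 + signDiff m m') ^ 2 := by
    simp only [Qint, signDiff]; ring
  have h9 := sq_nonneg (2 * n 0 + (n 1 + signDiff m m'))
  have h3 := sq_nonneg (3 * n 1 + signDiff m m')
  have h24 := sq_nonneg (2 * n 2 + signDiff m m')
  have hn : (![n 0, n 1, n 2] : Fin 3 → ℤ) = n := by
    ext i; fin_cases i <;> rfl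
  unfold classRange
  refine List.mem_flatMap.mpr ⟨(m, m'), mem_sublPairs _, ?_⟩
  show (m, m', n) ∈ classBlock qlo qhi m m'
  unfold classBlock
  refine List.mem_flatMap.mpr ⟨n 2, ?_, ?_⟩
  · have hb := abs_le_sqrt_div (a := 24) (k := 2 * n 2 + signDiff m m') (r := qhi) (by norm_num)
      (by linarith)
    unfold coordStrip; rw [mem_intIcc]; omega
  unfold classSlab
  refine List.mem_flatMap.mpr ⟨n 1, ?_, ?_⟩
  · have hb := abs_le_sqrt_div (a := 3) (k := 3 * n 1 + signDiff m m') (r := budget₂ qhi m m' (n 2))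
      (by norm_num) (by unfold budget₂; linarith)
    unfold coordStrip; rw [mem_intIcc]; omega
  refine mem_classCell.mpr ⟨⟨n 0, ?_, by rw [hn]⟩, hlo, hhi⟩
  refine mem_coordRays (abs_le_sqrt_div (by norm_num) (by unfold budget₁ budget₂; linarith)) fun hA hk => ?_
  have h1 : (2 * n 0 + (n 1 + signDiff m m')) ^ 2 ≤ Int.sqrt (budget₁ qlo m m' (n 2) (n 1) / 9) ^ 2 :=
    sq_le_sq' hk.1 hk.2
  have h2 := sqrt_sq_le hA
  have h4 : (9 : ℤ) * (budget₁ qlo m m' (n 2) (n 1) / 9) ≤ budget₁ qlo m m' (n 2) (n 1) :=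
    Int.mul_ediv_self_le (by norm_num)
  have h5 : budget₁ qlo m m' (n 2) (n 1) =
      qlo - 24 * (2 * n 2 + signDiff m m') ^ 2 - 3 * (3 * n 1 + signDiff m m') ^ 2 := rfl
  linarith

/-! ## No duplicates -/

/-- a `flatMap` over a duplicate-free list of duplicate-free lists whose members remember their index
has no duplicates. [folklore] -/
theorem nodup_flatMap_of_key {α β : Type*} {l : List α} {f : α → List β} (key : β → α)
    (hl : l.Nodup) (hf : ∀ a ∈ l, (f a).Nodup) (hk : ∀ a ∈ l, ∀ b ∈ f a, key b = a) :
    (l.flatMap f).Nodup := by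
  rw [List.nodup_flatMap]
  refine ⟨hf, hl.pairwise_of_forall_ne fun a ha a' ha' hne => ?_⟩
  intro b hb hb'
  exact hne ((hk a ha b hb).symm.trans (hk a' ha' b hb'))

/-- the class constructor of a cell is injective in `n₀`. [folklore] -/
theorem injective_mkClass (m m' : Fin 2) (n₂ n₁ : ℤ) :
    Injective fun n₀ : ℤ => ((m, m', ![n₀, n₁, n₂]) : BondClass) := by
  intro a b h
  have h' := congrArg (fun c : BondClass => c.2.2 0) h
  simpa using h'

/-- cells have no duplicates. [folklore] -/
theorem nodup_classCell (qlo qhi : ℤ) (m m' : Fin 2) (n₂ n₁ : ℤ) :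
    (classCell qlo qhi m m' n₂ n₁).Nodup := by
  unfold classCell
  exact List.Nodup.filter _ ((nodup_coordRays _ _ _).map (injective_mkClass m m' n₂ n₁))

/-- slabs have no duplicates. [folklore] -/
theorem nodup_classSlab (qlo qhi : ℤ) (m m' : Fin 2) (n₂ : ℤ) : (classSlab qlo qhi m m' n₂).Nodup := by
  unfold classSlab
  exact nodup_flatMap_of_key (fun c : BondClass => c.2.2 1) (nodup_coordStrip _ _ _)
    (fun n₁ _ => nodup_classCell qlo qhi m m' n₂ n₁) fun n₁ _ c hc => (shape_classCell hc).2.2.2.1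

/-- blocks have no duplicates. [folklore] -/
theorem nodup_classBlock (qlo qhi : ℤ) (m m' : Fin 2) : (classBlock qlo qhi m m').Nodup := by
  unfold classBlock
  exact nodup_flatMap_of_key (fun c : BondClass => c.2.2 2) (nodup_coordStrip _ _ _)
    (fun n₂ _ => nodup_classSlab qlo qhi m m' n₂) fun n₂ _ c hc => (shape_classSlab hc).2.2.1

/-- **no duplicates** in the exact range. [folklore] -/
theorem nodup_classRange (qlo qhi : ℤ) : (classRange qlo qhi).Nodup := by
  unfold classRange
  exact nodup_flatMap_of_key (fun c : BondClass => (c.1, c.2.1)) (by decide)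
    (fun p _ => nodup_classBlock qlo qhi p.1 p.2) fun p _ c hc => by
      obtain ⟨h1, h2, -⟩ := shape_classBlock hc
      exact Prod.ext h1 h2

/-! ## The registered stub -/

/-- **Exact-range enumeration (stub `stub_certRange`):** `classRange qlo qhi` is a duplicate-free list of
exactly the bond classes `c` with `qlo < Q(c) ≤ qhi`, `Q(c) = 36‖ζ⁰_c‖²`. [folklore] -/
theorem stub_certRange : ∀ qlo qhi : ℤ, (classRange qlo qhi).Nodup ∧
    ∀ c : BondClass, c ∈ classRange qlo qhi ↔ qlo < Qint c ∧ Qint c ≤ qhi :=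
  fun qlo qhi => ⟨nodup_classRange qlo qhi, fun _ =>
    ⟨qint_of_mem_classRange, fun h => mem_classRange_of_qint h.1 h.2⟩⟩

end Summit.AtomisticToContinuum.Crystallization.Theorems.PhononStabilityCWC.Cert

end
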